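import Summits.ResolutionOfSingularities.ResolutionOfSingularities.Theorems.FrobeniusLadderFRationalResolutionRootAdjoinRegularOfSubgroupChar
import Summits.ResolutionOfSingularities.ResolutionOfSingularities.Theorems.FrobeniusLadderFRationalResolutionFixedChartOfRoot
import Mathlib.Algebra.Module.ZMod
import Mathlib.LinearAlgebra.Basis.VectorSpace
import Mathlib.Algebra.Group.Hom.Basic
import Mathlib.Algebra.Field.ZMod
import Mathlib.GroupTheory.Perm.Cycle.Type
import HarnessLib

/-!
# Crux `FrobeniusLadder.FRationalResolution` (stmt-ResolutionOfSingularities-15317), line `redirect`,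
# stub `stub_diagonalizableQuotientResolution` — item (F2), root-adjunction step (R) UNCONDITIONAL in the wild case: a point whose
# unit-degree subgroup `B` satisfies `B + ⟨a⟩ = A`, `d • a = deg u ∉ p·B`, re-charts to a FIXED point; and `B ∖ p·B ≠ ∅` whenever
# `p ∣ |B|`

With `…RootAdjoinRegularOfSubgroupChar` (quotient Euler derivation ⇒ the hypothesis `hreg` of `…FixedChartOfRoot`) the only
input left is an additive character `χ : B →+ k` of the unit-degree subgroup with `χ (deg u) ≠ 0`. Over a field of characteristic
`p` such a character exists iff `deg u ∉ p·B` (`B/pB` is an `𝔽_p`-vector space and linear functionals separate points):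

* `exists_addMonoidHom_apply_ne_zero` — `g ∉ p·G` ⇒ `∃ χ : G →+ k, χ g ≠ 0` (`char k = p`);
* `exists_not_mem_nsmul_of_dvd_card` — `p ∣ |G|` ⇒ `p·G ≠ G` (Cauchy); so in the WILD case a degree `b ∈ B ∖ p·B` exists, and
  `S_b ⊄ 𝔔` by the definition of `B`;
* `isRegularLocalRing_localization_adjoinRoot_of_not_mem_nsmul` — `hreg` for `deg u ∉ p·B`;
* ★★★★ `exists_fixed_chart_of_subgroupChar` / `exists_fixed_chart_of_not_mem_nsmul` — item (F2) in the stub's frame, modulo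
  nothing: chart `(A, S, 𝒮, φ)`, point `v`, prime `𝔔` over `v` with unit-degree subgroup `B`, `u ∈ S_b ∖ 𝔔`, `d • a = b`,
  `B ⊔ ⟨a⟩ = ⊤`, `j • a ∉ B (0 < j < d)`, and `χ : B →+ k` with `χ b ≠ 0` (resp. `b ∉ p·B`) ⇒ `φ v` is the image of a FIXED point
  of a quotient chart of the same shape with the same invariants.

Compared with `…FixedChartOfAddChar` (`χ : A →+ k`, i.e. `b ∉ p·A`) this covers the residual core of MEMO-15317-leafhand2-g21
§3 (`A = ℤ/p²`, `B = pA`, `b = p`, `a = 1`, `d = p`). What remains of (F2) is the group bookkeeping (F2c): producing `a`, `d`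
with `B ⊔ ⟨a⟩ = ⊤`, `j • a ∉ B` after the split-off steps (S)/(T). Honest label: helper toward ONE leaf stub; no stub, crux or
summit closed. No definitions, no named facts, no sorry. [folklore; cite: SGA3, Exp. VIII §4–5]
[cite: Matsumura1987, Thm. 14.2; §25; §30, Cor. to Thm. 30.5]
-/

noncomputable section

-- single-problem summit: the doubled namespace component is forced
set_option linter.dupNamespace false

open CategoryTheory AlgebraicGeometry
open Literature.AlgebraicGeometry.Resolution

namespace Summit.ResolutionOfSingularities.ResolutionOfSingularities.Theorems.FRationalResolution.FixedChartOfWildDegree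

universe u v w

/-! ### Additive characters of a finite abelian group nonvanishing at `g ∉ p·G` -/

/-- **Linear functionals on `G/pG` separate points.** `k` a field of characteristic `p`, `G` an abelian group, `g ∉ p·G`:
there is an additive `χ : G →+ k` with `χ g ≠ 0`. [folklore] -/
theorem exists_addMonoidHom_apply_ne_zero (p : ℕ) [Fact p.Prime] (k : Type u) [Field k] [CharP k p]
    {G : Type v} [AddCommGroup G] {g : G} (hg : ∀ c : G, p • c ≠ g) : ∃ χ : G →+ k, χ g ≠ 0 := by
  let H : AddSubgroup G := (nsmulAddMonoidHom p : G →+ G).range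
  have hH : ∀ x : G, p • x ∈ H := fun x => ⟨x, nsmulAddMonoidHom_apply p x⟩
  letI inst : Module (ZMod p) (G ⧸ H) := QuotientAddGroup.zmodModule hH
  have hg0 : (QuotientAddGroup.mk g : G ⧸ H) ≠ 0 := by
    intro h
    rw [QuotientAddGroup.eq_zero_iff] at h
    obtain ⟨c, hc⟩ := h
    exact hg c (by rw [← hc, nsmulAddMonoidHom_apply])
  -- a coordinate functional of a basis of the `𝔽_p`-vector space `G/pG` does not vanish on `ḡ` (the applications are left to
  -- unification: `ZMod p`-instances on the quotient do not elaborate from source)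
  let bV := @Module.Basis.ofVectorSpace (ZMod p) (G ⧸ H) _ _ inst
  obtain ⟨j, hj⟩ := not_forall.mp (mt bV.forall_coord_eq_zero_iff.mp hg0)
  refine ⟨(ZMod.castHom (dvd_refl p) k).toAddMonoidHom.comp ((bV.coord j).toAddMonoidHom.comp (QuotientAddGroup.mk' H)),
    fun h => hj ?_⟩
  apply ZMod.castHom_injective k
  rw [map_zero]
  exact h

/-- **`p·G ≠ G` when `p ∣ |G|`** (`G` finite abelian): multiplication by `p` is not injective (Cauchy), hence not surjective.
[folklore] -/
theorem exists_not_mem_nsmul_of_dvd_card (p : ℕ) [hp : Fact p.Prime] {G : Type v} [AddCommGroup G] [Finite G]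
    (hdvd : p ∣ Nat.card G) : ∃ g : G, ∀ c : G, p • c ≠ g := by
  by_contra h
  have hsurj : Function.Surjective (nsmulAddMonoidHom p : G →+ G) := fun g => by
    by_contra h'
    exact h ⟨g, fun c hc => h' ⟨c, by rw [nsmulAddMonoidHom_apply, hc]⟩⟩
  have hinj : Function.Injective (nsmulAddMonoidHom p : G →+ G) := Finite.injective_iff_surjective.2 hsurj
  obtain ⟨x, hx⟩ := exists_prime_addOrderOf_dvd_card' (G := G) p hdvd
  have hpx : p • x = 0 := by rw [← hx]; exact addOrderOf_nsmul_eq_zero x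
  have hx0 : x = 0 := hinj (by rw [nsmulAddMonoidHom_apply, nsmulAddMonoidHom_apply, hpx, smul_zero])
  rw [hx0, addOrderOf_zero] at hx
  exact hp.out.one_lt.ne hx

/-! ### `hreg` for `deg u ∉ p·B` -/

/-- **The root-adjunction chart is regular at the primes over the point when `deg u ∉ p·B`.** `k` a field of characteristic
`p`, `S` regular graded by the torsion group `A`, `𝔔` a prime, `B ≤ A` with `S_i ⊆ 𝔔` for `i ∉ B`, `u ∈ S_b ∖ 𝔔` with `b ∈ B ∖ p·B`:
`AdjoinRoot (X^d − C u)` is regular at every prime over the point `𝔔 ∩ S₀`. [folklore; cite: SGA3, Exp. VIII §4–5]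
[cite: Matsumura1987, Thm. 14.2; §25] -/
theorem isRegularLocalRing_localization_adjoinRoot_of_not_mem_nsmul (p : ℕ) [Fact p.Prime] {k : Type u} [Field k]
    [CharP k p] {A : Type w} [DecidableEq A] [AddCommGroup A] {S : Type u} [CommRing S] [Algebra k S]
    (𝒮 : A → Submodule k S) [GradedAlgebra 𝒮] [IsRegularRing S] (hA : AddMonoid.IsTorsion A) (𝔔 : Ideal S) [𝔔.IsPrime]
    (B : AddSubgroup A) (hB : ∀ i : A, i ∉ B → ∀ s ∈ 𝒮 i, s ∈ 𝔔) {b : A} (hb : b ∈ B) (hpb : ∀ c ∈ B, p • c ≠ b)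
    {u : S} (hu : u ∈ 𝒮 b) (huQ : u ∉ 𝔔) (d : ℕ)
    (𝔓 : Ideal (AdjoinRoot (Polynomial.X ^ d - Polynomial.C u : Polynomial S))) [𝔓.IsPrime]
    (h𝔓 : 𝔓.comap (algebraMap (𝒮 0) (AdjoinRoot (Polynomial.X ^ d - Polynomial.C u : Polynomial S))) =
      𝔔.comap (algebraMap (𝒮 0) S)) :
    IsRegularLocalRing (Localization.AtPrime 𝔓) := by
  obtain ⟨χ, hχ⟩ := exists_addMonoidHom_apply_ne_zero p k (G := B) (g := ⟨b, hb⟩) fun c hc =>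
    hpb c c.2 (by simpa using congrArg Subtype.val hc)
  exact RootAdjoinRegularOfSubgroupChar.isRegularLocalRing_localization_adjoinRoot_of_subgroupChar 𝒮 hA 𝔔 B hB hb hu huQ χ
    (isUnit_iff_ne_zero.2 hχ) d 𝔓 h𝔓

/-! ### The assembled re-charting, unconditionally -/

/-- ★★★★ **Item (F2), subgroup-character case, unconditionally.** Chart `(A, S, 𝒮, φ)` of the stub's shape with `S` regular,
point `v`, prime `𝔔` over `v` with unit-degree subgroup `B`, a homogeneous `u ∈ S_b ∖ 𝔔`, `d • a = b` (`d ≥ 2`), `B ⊔ ⟨a⟩ = ⊤`,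
`j • a ∉ B` for `0 < j < d`, and an additive `χ : B →+ k` with `χ b ≠ 0`: `φ v` is the image of a FIXED point of a quotient chart
of the same shape with the same invariants. [folklore; cite: SGA3, Exp. VIII §4–5]
[cite: Matsumura1987, Thm. 14.2; §25; §30, Cor. to Thm. 30.5] -/
theorem exists_fixed_chart_of_subgroupChar (k : Type) [Field k] (X : Scheme.{0}) (g : X ⟶ Spec (.of k))
    (A : Type) [AddCommGroup A] [Finite A] [DecidableEq A] (S : Type) [CommRing S] [Algebra k S]
    (𝒮 : A → Submodule k S) [GradedAlgebra 𝒮] [Algebra.FiniteType k S] [IsRegularRing S]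
    (φ : Spec (.of (𝒮 0)) ⟶ X) [Etale φ]
    (hφg : φ ≫ g = Spec.map (CommRingCat.ofHom (algebraMap k (𝒮 0))))
    (v : Spec (.of (𝒮 0))) (𝔔 : Ideal S) [𝔔.IsPrime] (h𝔔v : 𝔔.comap (algebraMap (𝒮 0) S) = v.asIdeal)
    (B : AddSubgroup A) (hB : ∀ i : A, i ∈ B ↔ ∃ s ∈ 𝒮 i, s ∉ 𝔔)
    (u : S) (b : A) (hu : u ∈ 𝒮 b) (huQ : u ∉ 𝔔) (a : A) (d : ℕ) (hd : 1 < d) (hab : d • a = b)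
    (hgen : B ⊔ AddSubgroup.zmultiples a = ⊤) (hmin : ∀ j : ℕ, 0 < j → j < d → j • a ∉ B)
    (hb : b ∈ B) (χ : B →+ k) (hχ : χ ⟨b, hb⟩ ≠ 0) :
    ∃ (A' : Type) (_ : AddCommGroup A') (_ : Finite A') (_ : DecidableEq A')
      (S' : Type) (_ : CommRing S') (_ : Algebra k S') (𝒮' : A' → Submodule k S')
      (_ : GradedAlgebra 𝒮'),
      Algebra.FiniteType k S' ∧ IsRegularRing S' ∧
      ∃ (φ' : Spec (.of (𝒮' 0)) ⟶ X), Etale φ' ∧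
        φ' ≫ g = Spec.map (CommRingCat.ofHom (algebraMap k (𝒮' 0))) ∧
        ∃ (v' : Spec (.of (𝒮' 0))) (𝔔' : Ideal S') (_ : 𝔔'.IsPrime),
          𝔔'.comap (algebraMap (𝒮' 0) S') = v'.asIdeal ∧
          (∀ c : A', c ≠ 0 → ∀ s ∈ 𝒮' c, s ∈ 𝔔') ∧ φ' v' = φ v := by
  have hA : AddMonoid.IsTorsion A := fun i => isOfFinAddOrder_of_finite i
  have hB' : ∀ i : A, i ∉ B → ∀ s ∈ 𝒮 i, s ∈ 𝔔 := fun i hi s hs => by_contra fun h => hi ((hB i).2 ⟨s, hs, h⟩)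
  exact FixedChartOfRoot.exists_fixed_chart_of_rootAdjoin k X g A S 𝒮 φ hφg v 𝔔 h𝔔v B hB u b hu huQ a d hd hab hgen hmin
    fun 𝔓 _ h𝔓 => RootAdjoinRegularOfSubgroupChar.isRegularLocalRing_localization_adjoinRoot_of_subgroupChar 𝒮 hA 𝔔 B hB'
      hb hu huQ χ (isUnit_iff_ne_zero.2 hχ) d 𝔓 (h𝔓.trans h𝔔v.symm)

/-- ★★★★ **Item (F2), wild degree, unconditionally.** As `exists_fixed_chart_of_subgroupChar`, over a field of characteristic
`p`, with the character replaced by the condition `deg u ∉ p·B` on the unit-degree subgroup `B` (e.g. `A = ℤ/p²`, `B = pA`,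
`deg u = p`, `a = 1`, `d = p`: the residual core of MEMO-15317-leafhand2-g21 §3). [folklore; cite: SGA3, Exp. VIII §4–5]
[cite: Matsumura1987, Thm. 14.2; §25; §30, Cor. to Thm. 30.5] -/
theorem exists_fixed_chart_of_not_mem_nsmul (p : ℕ) [Fact p.Prime] (k : Type) [Field k] [CharP k p] (X : Scheme.{0})
    (g : X ⟶ Spec (.of k))
    (A : Type) [AddCommGroup A] [Finite A] [DecidableEq A] (S : Type) [CommRing S] [Algebra k S]
    (𝒮 : A → Submodule k S) [GradedAlgebra 𝒮] [Algebra.FiniteType k S] [IsRegularRing S]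
    (φ : Spec (.of (𝒮 0)) ⟶ X) [Etale φ]
    (hφg : φ ≫ g = Spec.map (CommRingCat.ofHom (algebraMap k (𝒮 0))))
    (v : Spec (.of (𝒮 0))) (𝔔 : Ideal S) [𝔔.IsPrime] (h𝔔v : 𝔔.comap (algebraMap (𝒮 0) S) = v.asIdeal)
    (B : AddSubgroup A) (hB : ∀ i : A, i ∈ B ↔ ∃ s ∈ 𝒮 i, s ∉ 𝔔)
    (u : S) (b : A) (hu : u ∈ 𝒮 b) (huQ : u ∉ 𝔔) (a : A) (d : ℕ) (hd : 1 < d) (hab : d • a = b)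
    (hgen : B ⊔ AddSubgroup.zmultiples a = ⊤) (hmin : ∀ j : ℕ, 0 < j → j < d → j • a ∉ B)
    (hpb : ∀ c ∈ B, p • c ≠ b) :
    ∃ (A' : Type) (_ : AddCommGroup A') (_ : Finite A') (_ : DecidableEq A')
      (S' : Type) (_ : CommRing S') (_ : Algebra k S') (𝒮' : A' → Submodule k S')
      (_ : GradedAlgebra 𝒮'),
      Algebra.FiniteType k S' ∧ IsRegularRing S' ∧
      ∃ (φ' : Spec (.of (𝒮' 0)) ⟶ X), Etale φ' ∧
        φ' ≫ g = Spec.map (CommRingCat.ofHom (algebraMap k (𝒮' 0))) ∧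
        ∃ (v' : Spec (.of (𝒮' 0))) (𝔔' : Ideal S') (_ : 𝔔'.IsPrime),
          𝔔'.comap (algebraMap (𝒮' 0) S') = v'.asIdeal ∧
          (∀ c : A', c ≠ 0 → ∀ s ∈ 𝒮' c, s ∈ 𝔔') ∧ φ' v' = φ v := by
  have hb : b ∈ B := (hB b).2 ⟨u, hu, huQ⟩
  obtain ⟨χ, hχ⟩ := exists_addMonoidHom_apply_ne_zero p k (G := B) (g := ⟨b, hb⟩) fun c hc =>
    hpb c c.2 (by simpa using congrArg Subtype.val hc)
  exact exists_fixed_chart_of_subgroupChar k X g A S 𝒮 φ hφg v 𝔔 h𝔔v B hB u b hu huQ a d hd hab hgen hmin hb χ hχ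

end Summit.ResolutionOfSingularities.ResolutionOfSingularities.Theorems.FRationalResolution.FixedChartOfWildDegree

end
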